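/-
Copyright (c) 2026 the pub-hodgecm-mathlib formalisation cell (harness21).  Prover seat hodgecm-mathlib-B-p14 (g33), 2026-09-01.  Road «W′» = «R1LL-WILD»
((W′-B6) sub-socket (B6-V), owner B-p14 (g33)): THE DESCENT OF THE SHELL CONJUGATE `(r_m)⁻¹ (E₂ t) r_m`, `r_m = uη⁻¹ ^ m`, and the `fbar` link — the package promised
to (V-deep) B-p10 (g27) and (V-top) A-p17 (g23) (bus 12:41Z).
-/
import Literature.NumberTheory.Rogawski1990.RankOneKappaShellAverageRenormalise      -- ★ p844282 (this seat): the `H_v` carrier, `prod_symm_conj_eq`; brings ★ p844158 `descent_conj_eq_smul_map_conj`, `descent_inv_eq_inv_smul_map_inv`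
import Literature.NumberTheory.LocalFields.QuadraticOrderRegularRepShells              -- ★ p843859 (p08): `diagonal_inv_mul_regRep_mul_diagonal` (LL (2.1))
import Literature.NumberTheory.Automorphic.GLnAdelicStructure                           -- ★ `glDiagonal`, `coe_glDiagonal`
import HarnessLib

/-!
# The descent of the shell conjugate `r_m⁻¹ · E₂(t) · r_m` (`r_m = uη⁻¹ ^ m`) and the `fbar` link (road «W′», (B6-V))

Topic `NumberTheory/Rogawski1990`; namespace `Literature.NumberTheory.Rogawski1990`.  THEOREMS ONLY (no definition, no instance, no notation, no named fact, no `sorry`); kernel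
lane.  Cell `pub/hodgecm-mathlib`, crux H413 = stmt-HodgeConjecture-24833; road «W′» = «R1LL-WILD» ((W′-B6) F0P3-p01 (g14); (B6-V) owner B-p14 (g33), sub-sockets (V-deep) B-p10 (g27),
(V-top) A-p17 (g23): this file is the shared PACKAGE they key to).
HONEST LABEL: HC_CM is proved only modulo the cell's 2 remaining named inputs (hLiu418, h413) until rung 0 closes; matrix bookkeeping over ★ files, print cited for orientation.

THE MATHEMATICS [LabesseLanglands1979 §2 (2.1) p. 8; Serre1980Trees II §1.3].  The (W′-B6) shell average is `fbar m x = ∫_{K×U₁} f(k⁻¹ · ((E₂⁻¹ r_m, 1)⁻¹ x (E₂⁻¹ r_m, 1)) · k)`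
with `r_m := uη⁻¹ ^ m ∈ U_w`, `uη = diag(η, (σ_w η)⁻¹)` (`η` a uniformiser of `L_w`).  (i) `(E₂⁻¹ r_m, 1)⁻¹ (t₁, t₂) (E₂⁻¹ r_m, 1) = (E₂⁻¹ (r_m⁻¹ E₂(t₁) r_m), t₂)` — so
`fbar m ↑t` is the `K × U₁`-average at the SHELL CONJUGATE `X_m := r_m⁻¹ E₂(t₁) r_m`.  (ii) Projective descents MULTIPLY (`d (XY) d⁻¹ = (s s′) · ι(g g′)`), so from the
descent `η⁻¹ · ι(diag(1, c))` of `uη⁻¹` (`ι c = η σ_w η`, a uniformiser of `L⁺_v` at a ramified place) one gets `d r_m d⁻¹ = η⁻ᵐ · ι(diag(1, c)^m)`, and (iii) by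
★ `descent_conj_eq_smul_map_conj` the shell conjugate of an element with descent `s · ι(γ)` has descent `s · ι(diag(1,c^m)⁻¹ γ diag(1,c^m))` — for `γ = (a, b v₀; b, a + b u₀)`
this is LL's (2.1) matrix `(a, b v₀ c^m; b c^{−m}, a + b u₀)` (★ p08 `diagonal_inv_mul_regRep_mul_diagonal`).

* §1 (generic `(ι σ α)`): `descent_mul`, `descent_pow`.
* §2 (place): `descent_uη_inv` (`d uη⁻¹ d⁻¹ = η⁻¹ · ι(D_c)`), `descent_uη_inv_pow`, **`descent_shellConjugate`**, `coe_glDiagonal_pow_conj_regRep` (the (2.1) matrix),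
  **`descent_shellConjugate_regRep`**.
* §3 (`H_v`): **`prod_symm_pow_conj_eq`** (`(E₂⁻¹ r, 1)⁻¹ · x · (E₂⁻¹ r, 1) = (E₂⁻¹(r⁻¹ E₂(x₁) r), x₂)`) — so `fbar m x` IS the shell-conjugate average.

## References
* [LabesseLanglands1979] J.-P. Labesse, R. P. Langlands, *L-indistinguishability for SL(2)*, Canad. J. Math. 31 (1979): §2 (2.1) p. 8.
* [Serre1980Trees] J.-P. Serre, *Trees* (1980): Ch. II §1.3.
-/

set_option autoImplicit false

noncomputable section

open MeasureTheory Topology Set Function NumberField IsDedekindDomain ValuativeRel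
open scoped MatrixGroups Matrix ValuativeRel

namespace Literature.NumberTheory.Rogawski1990

open Literature.NumberTheory.Automorphic Literature.NumberTheory.Automorphic.UnitaryGroup Literature.NumberTheory.GaloisRepresentations
  Literature.NumberTheory.Automorphic.HermitianLatticeTree Literature.NumberTheory.LocalFields.QuadraticRegularRep

/-! ## §1 Projective descents multiply -/

section Generic

variable {F E : Type*} [Field F] [Field E] (ι : F →+* E) {α : E}

/-- **Descents multiply**: `d X d⁻¹ = s·ι(g)`, `d Y d⁻¹ = s′·ι(g′)` ⇒ `d (XY) d⁻¹ = (s s′)·ι(g g′)` (`d = diag(1,α)`). [cite: Serre1980Trees, Ch. II §1.3] -/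
theorem descent_mul (hα0 : α ≠ 0) {X Y : GL (Fin 2) E} {s s' : E} {g g' : GL (Fin 2) F}
    (hX : Matrix.diagonal ![1, α] * (X : Matrix (Fin 2) (Fin 2) E) * Matrix.diagonal ![1, α⁻¹] = s • (g : Matrix (Fin 2) (Fin 2) F).map ι)
    (hY : Matrix.diagonal ![1, α] * (Y : Matrix (Fin 2) (Fin 2) E) * Matrix.diagonal ![1, α⁻¹] = s' • (g' : Matrix (Fin 2) (Fin 2) F).map ι) :
    Matrix.diagonal ![1, α] * ((X * Y : GL (Fin 2) E) : Matrix (Fin 2) (Fin 2) E) * Matrix.diagonal ![1, α⁻¹] =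
      (s * s') • ((g * g' : GL (Fin 2) F) : Matrix (Fin 2) (Fin 2) F).map ι := by
  have hsplit : Matrix.diagonal ![1, α] * ((X * Y : GL (Fin 2) E) : Matrix (Fin 2) (Fin 2) E) * Matrix.diagonal ![1, α⁻¹] =
      (Matrix.diagonal ![1, α] * (X : Matrix (Fin 2) (Fin 2) E) * Matrix.diagonal ![1, α⁻¹]) *
        (Matrix.diagonal ![1, α] * (Y : Matrix (Fin 2) (Fin 2) E) * Matrix.diagonal ![1, α⁻¹]) := by
    rw [Units.val_mul]
    simp only [Matrix.mul_assoc]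
    rw [← Matrix.mul_assoc (Matrix.diagonal ![1, α⁻¹]) (Matrix.diagonal ![1, α]), UnitaryGroup.diagonal_inv_mul_diagonal hα0, Matrix.one_mul]
  rw [hsplit, hX, hY, Matrix.smul_mul, Matrix.mul_smul, smul_smul, Units.val_mul, Matrix.map_mul]

/-- **Descents of powers**: `d X d⁻¹ = s·ι(g)` ⇒ `d Xᵐ d⁻¹ = sᵐ·ι(gᵐ)`. [cite: Serre1980Trees, Ch. II §1.3] -/
theorem descent_pow (hα0 : α ≠ 0) {X : GL (Fin 2) E} {s : E} {g : GL (Fin 2) F}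
    (hX : Matrix.diagonal ![1, α] * (X : Matrix (Fin 2) (Fin 2) E) * Matrix.diagonal ![1, α⁻¹] = s • (g : Matrix (Fin 2) (Fin 2) F).map ι) (m : ℕ) :
    Matrix.diagonal ![1, α] * ((X ^ m : GL (Fin 2) E) : Matrix (Fin 2) (Fin 2) E) * Matrix.diagonal ![1, α⁻¹] =
      (s ^ m) • ((g ^ m : GL (Fin 2) F) : Matrix (Fin 2) (Fin 2) F).map ι := by
  induction m with
  | zero =>
    rw [pow_zero, pow_zero, pow_zero, Units.val_one, Matrix.mul_one, UnitaryGroup.diagonal_mul_diagonal_inv hα0, Units.val_one,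
      Matrix.map_one ι (map_zero ι) (map_one ι), one_smul]
  | succ m ih =>
    rw [pow_succ, pow_succ, pow_succ]
    exact descent_mul ι hα0 ih hX

end Generic

/-! ## §2 At a ramified place: the descent of `uη⁻¹ ^ m` and of the shell conjugate -/

section Place

variable (L : Type) [Field L] [NumberField L] [IsCMField L] (v : HeightOneSpectrum (𝓞 ↥(maximalRealSubfield L)))
  (w : PlacesOver L v) (hw : IsCMField.complexConj L • w.1 = w.1)
  {α : (w.1.adicCompletion L)} (hα0 : α ≠ 0)

omit [IsCMField L] in
/-- The matrix of `D_c ^ m`, `D_c := glDiagonal ![1, c]`: `diag(1, c^m)`. [folklore] -/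
private theorem coe_glDiagonal_one_mk0_pow {c : (v.adicCompletion ↥(maximalRealSubfield L))} (hc : c ≠ 0) (m : ℕ) :
    (((glDiagonal 2 (v.adicCompletion ↥(maximalRealSubfield L)) ![1, Units.mk0 (c) (hc)]) ^ m : GL (Fin 2) (v.adicCompletion ↥(maximalRealSubfield L))) : Matrix (Fin 2) (Fin 2) (v.adicCompletion ↥(maximalRealSubfield L))) = Matrix.diagonal ![1, c ^ m] := by
  rw [← map_pow, coe_glDiagonal]
  congr 1
  funext k
  fin_cases k <;> simp

omit [IsCMField L] in
/-- The matrix of `(D_c ^ m)⁻¹`: `diag(1, (c^m)⁻¹)`. [folklore] -/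
private theorem coe_glDiagonal_one_mk0_pow_inv {c : (v.adicCompletion ↥(maximalRealSubfield L))} (hc : c ≠ 0) (m : ℕ) :
    ((((glDiagonal 2 (v.adicCompletion ↥(maximalRealSubfield L)) ![1, Units.mk0 (c) (hc)]) ^ m)⁻¹ : GL (Fin 2) (v.adicCompletion ↥(maximalRealSubfield L))) : Matrix (Fin 2) (Fin 2) (v.adicCompletion ↥(maximalRealSubfield L))) = Matrix.diagonal ![1, (c ^ m)⁻¹] := by
  rw [← map_pow, ← map_inv, coe_glDiagonal]
  congr 1
  funext k
  fin_cases k <;> simp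

omit [IsCMField L] in
/-- The matrix of `D_c⁻¹`: `diag(1, c⁻¹)`. [folklore] -/
private theorem coe_glDiagonal_one_mk0_inv {c : (v.adicCompletion ↥(maximalRealSubfield L))} (hc : c ≠ 0) :
    ((((glDiagonal 2 (v.adicCompletion ↥(maximalRealSubfield L)) ![1, Units.mk0 (c) (hc)]))⁻¹ : GL (Fin 2) (v.adicCompletion ↥(maximalRealSubfield L))) : Matrix (Fin 2) (Fin 2) (v.adicCompletion ↥(maximalRealSubfield L))) = Matrix.diagonal ![1, c⁻¹] := by
  rw [← map_inv, coe_glDiagonal]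
  congr 1
  funext k
  fin_cases k <;> simp

include hα0 in
/-- **The descent of `uη`**: for `uη = diag(η, (σ_w η)⁻¹) ∈ U_w` and `ι c = η · σ_w η` (`c ≠ 0`): `diag(1,α) uη diag(1,α)⁻¹ = η · ι(D_c⁻¹)`. [cite: Serre1980Trees, Ch. II §1.3] -/
theorem descent_uη (uη : ↥(unitaryGroupOfForm (galAdicCompletionMap (L := L) (IsCMField.complexConj L) hw) (placeForm (Matrix.of fun i j : Fin 2 => if i.val + j.val + 1 = 2 then (1 : L) else 0) w.1))) {η : (w.1.adicCompletion L)} (hη0 : η ≠ 0)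
    (huη : ((uη : GL (Fin 2) (w.1.adicCompletion L)) : Matrix (Fin 2) (Fin 2) (w.1.adicCompletion L)) = Matrix.diagonal ![η, ((galAdicCompletionMap (L := L) (IsCMField.complexConj L) hw) η)⁻¹])
    {c : (v.adicCompletion ↥(maximalRealSubfield L))} (hc0 : c ≠ 0) (hc : toPlace v w c = η * (galAdicCompletionMap (L := L) (IsCMField.complexConj L) hw) η) :
    Matrix.diagonal ![1, α] * ((uη : GL (Fin 2) (w.1.adicCompletion L)) : Matrix (Fin 2) (Fin 2) (w.1.adicCompletion L)) * Matrix.diagonal ![1, α⁻¹] =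
      η • ((((glDiagonal 2 (v.adicCompletion ↥(maximalRealSubfield L)) ![1, Units.mk0 (c) (hc0)]))⁻¹ : GL (Fin 2) (v.adicCompletion ↥(maximalRealSubfield L))) : Matrix (Fin 2) (Fin 2) (v.adicCompletion ↥(maximalRealSubfield L))).map (toPlace v w) := by
  have hση0 : (galAdicCompletionMap (L := L) (IsCMField.complexConj L) hw) η ≠ 0 := (map_ne_zero _).2 hη0
  have key : α * ((galAdicCompletionMap (L := L) (IsCMField.complexConj L) hw) η)⁻¹ * α⁻¹ =
      η * (toPlace v w c)⁻¹ := by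
    rw [hc, mul_inv, ← mul_assoc η, mul_inv_cancel₀ hη0, one_mul, mul_comm α, mul_assoc, mul_inv_cancel₀ hα0,
      mul_one]
  rw [huη, coe_glDiagonal_one_mk0_inv L v hc0, Matrix.diagonal_mul_diagonal, Matrix.diagonal_mul_diagonal,
    Matrix.diagonal_map (map_zero _), ← Matrix.diagonal_smul, Matrix.diagonal_eq_diagonal_iff]
  intro i
  fin_cases i
  · simp
  · simpa [map_inv₀] using key

include hα0 in
/-- **The descent of `uη⁻¹`**: `diag(1,α) uη⁻¹ diag(1,α)⁻¹ = η⁻¹ · ι(D_c)` (★ `descent_inv_eq_inv_smul_map_inv`). [cite: Serre1980Trees, Ch. II §1.3] -/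
theorem descent_uη_inv (uη : ↥(unitaryGroupOfForm (galAdicCompletionMap (L := L) (IsCMField.complexConj L) hw) (placeForm (Matrix.of fun i j : Fin 2 => if i.val + j.val + 1 = 2 then (1 : L) else 0) w.1))) {η : (w.1.adicCompletion L)} (hη0 : η ≠ 0)
    (huη : ((uη : GL (Fin 2) (w.1.adicCompletion L)) : Matrix (Fin 2) (Fin 2) (w.1.adicCompletion L)) = Matrix.diagonal ![η, ((galAdicCompletionMap (L := L) (IsCMField.complexConj L) hw) η)⁻¹])
    {c : (v.adicCompletion ↥(maximalRealSubfield L))} (hc0 : c ≠ 0) (hc : toPlace v w c = η * (galAdicCompletionMap (L := L) (IsCMField.complexConj L) hw) η) :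
    Matrix.diagonal ![1, α] * (((uη⁻¹ : ↥(unitaryGroupOfForm (galAdicCompletionMap (L := L) (IsCMField.complexConj L) hw) (placeForm (Matrix.of fun i j : Fin 2 => if i.val + j.val + 1 = 2 then (1 : L) else 0) w.1))) : GL (Fin 2) (w.1.adicCompletion L)) : Matrix (Fin 2) (Fin 2) (w.1.adicCompletion L)) * Matrix.diagonal ![1, α⁻¹] =
      η⁻¹ • (((glDiagonal 2 (v.adicCompletion ↥(maximalRealSubfield L)) ![1, Units.mk0 (c) (hc0)]) : GL (Fin 2) (v.adicCompletion ↥(maximalRealSubfield L))) : Matrix (Fin 2) (Fin 2) (v.adicCompletion ↥(maximalRealSubfield L))).map (toPlace v w) := by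
  have h := descent_inv_eq_inv_smul_map_inv (toPlace v w) hα0 hη0 (descent_uη L v w hw hα0 uη hη0 huη hc0 hc)
  rw [inv_inv] at h
  rw [Subgroup.coe_inv]
  exact h

include hα0 in
/-- **The descent of `r_m = uη⁻¹ ^ m`**: `diag(1,α) r_m diag(1,α)⁻¹ = η⁻ᵐ · ι(D_c ^ m)`. [cite: Serre1980Trees, Ch. II §1.3] [cite: LabesseLanglands1979, §2 p. 8] -/
theorem descent_uη_inv_pow (uη : ↥(unitaryGroupOfForm (galAdicCompletionMap (L := L) (IsCMField.complexConj L) hw) (placeForm (Matrix.of fun i j : Fin 2 => if i.val + j.val + 1 = 2 then (1 : L) else 0) w.1))) {η : (w.1.adicCompletion L)} (hη0 : η ≠ 0)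
    (huη : ((uη : GL (Fin 2) (w.1.adicCompletion L)) : Matrix (Fin 2) (Fin 2) (w.1.adicCompletion L)) = Matrix.diagonal ![η, ((galAdicCompletionMap (L := L) (IsCMField.complexConj L) hw) η)⁻¹])
    {c : (v.adicCompletion ↥(maximalRealSubfield L))} (hc0 : c ≠ 0) (hc : toPlace v w c = η * (galAdicCompletionMap (L := L) (IsCMField.complexConj L) hw) η) (m : ℕ) :
    Matrix.diagonal ![1, α] * (((uη⁻¹ ^ m : ↥(unitaryGroupOfForm (galAdicCompletionMap (L := L) (IsCMField.complexConj L) hw) (placeForm (Matrix.of fun i j : Fin 2 => if i.val + j.val + 1 = 2 then (1 : L) else 0) w.1))) : GL (Fin 2) (w.1.adicCompletion L)) : Matrix (Fin 2) (Fin 2) (w.1.adicCompletion L)) * Matrix.diagonal ![1, α⁻¹] =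
      (η⁻¹) ^ m • (((glDiagonal 2 (v.adicCompletion ↥(maximalRealSubfield L)) ![1, Units.mk0 (c) (hc0)]) ^ m : GL (Fin 2) (v.adicCompletion ↥(maximalRealSubfield L))) : Matrix (Fin 2) (Fin 2) (v.adicCompletion ↥(maximalRealSubfield L))).map (toPlace v w) := by
  have h := descent_pow (toPlace v w) hα0 (descent_uη_inv L v w hw hα0 uη hη0 huη hc0 hc) m
  rw [Subgroup.coe_pow]
  exact h

include hα0 in
/-- **THE DESCENT OF THE SHELL CONJUGATE** `X_m := r_m⁻¹ · T · r_m`, `r_m = uη⁻¹ ^ m`: if `T ∈ U_w` has descent `s · ι(γ)` then `X_m` has descent `s · ι((D_c^m)⁻¹ γ D_c^m)`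
(★ `descent_conj_eq_smul_map_conj`; the scalar `η⁻ᵐ` of `r_m` cancels). [cite: LabesseLanglands1979, §2 (2.1) p. 8] -/
theorem descent_shellConjugate (uη T : ↥(unitaryGroupOfForm (galAdicCompletionMap (L := L) (IsCMField.complexConj L) hw) (placeForm (Matrix.of fun i j : Fin 2 => if i.val + j.val + 1 = 2 then (1 : L) else 0) w.1))) {η : (w.1.adicCompletion L)} (hη0 : η ≠ 0)
    (huη : ((uη : GL (Fin 2) (w.1.adicCompletion L)) : Matrix (Fin 2) (Fin 2) (w.1.adicCompletion L)) = Matrix.diagonal ![η, ((galAdicCompletionMap (L := L) (IsCMField.complexConj L) hw) η)⁻¹])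
    {c : (v.adicCompletion ↥(maximalRealSubfield L))} (hc0 : c ≠ 0) (hc : toPlace v w c = η * (galAdicCompletionMap (L := L) (IsCMField.complexConj L) hw) η) (m : ℕ)
    {s : (w.1.adicCompletion L)} {γ : GL (Fin 2) (v.adicCompletion ↥(maximalRealSubfield L))}
    (hT : Matrix.diagonal ![1, α] * ((T : GL (Fin 2) (w.1.adicCompletion L)) : Matrix (Fin 2) (Fin 2) (w.1.adicCompletion L)) * Matrix.diagonal ![1, α⁻¹] = s • (γ : Matrix (Fin 2) (Fin 2) (v.adicCompletion ↥(maximalRealSubfield L))).map (toPlace v w)) :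
    Matrix.diagonal ![1, α] * ((((uη⁻¹ ^ m)⁻¹ * T * uη⁻¹ ^ m : ↥(unitaryGroupOfForm (galAdicCompletionMap (L := L) (IsCMField.complexConj L) hw) (placeForm (Matrix.of fun i j : Fin 2 => if i.val + j.val + 1 = 2 then (1 : L) else 0) w.1))) : GL (Fin 2) (w.1.adicCompletion L)) : Matrix (Fin 2) (Fin 2) (w.1.adicCompletion L)) * Matrix.diagonal ![1, α⁻¹] =
      s • ((((glDiagonal 2 (v.adicCompletion ↥(maximalRealSubfield L)) ![1, Units.mk0 (c) (hc0)]) ^ m)⁻¹ * γ * (glDiagonal 2 (v.adicCompletion ↥(maximalRealSubfield L)) ![1, Units.mk0 (c) (hc0)]) ^ m : GL (Fin 2) (v.adicCompletion ↥(maximalRealSubfield L))) : Matrix (Fin 2) (Fin 2) (v.adicCompletion ↥(maximalRealSubfield L))).map (toPlace v w) := by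
  have h := descent_conj_eq_smul_map_conj (toPlace v w) hα0 (pow_ne_zero m (inv_ne_zero hη0)) (X := (T : GL (Fin 2) (w.1.adicCompletion L)))
    (k := ((uη⁻¹ ^ m : ↥(unitaryGroupOfForm (galAdicCompletionMap (L := L) (IsCMField.complexConj L) hw) (placeForm (Matrix.of fun i j : Fin 2 => if i.val + j.val + 1 = 2 then (1 : L) else 0) w.1))) : GL (Fin 2) (w.1.adicCompletion L))) hT (descent_uη_inv_pow L v w hw hα0 uη hη0 huη hc0 hc m)
  rw [Subgroup.coe_mul, Subgroup.coe_mul, Subgroup.coe_inv]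
  exact h

omit [IsCMField L] in
/-- **LL (2.1) at the shell**: `(D_c^m)⁻¹ (a, b v₀; b, a + b u₀) D_c^m = (a, b v₀ c^m; b (c^m)⁻¹, a + b u₀)` (★ p08 `diagonal_inv_mul_regRep_mul_diagonal`). [cite: LabesseLanglands1979, §2 (2.1) p. 8] -/
theorem coe_glDiagonal_pow_conj_regRep {c : (v.adicCompletion ↥(maximalRealSubfield L))} (hc0 : c ≠ 0) (m : ℕ) (u₀ v₀ a b : (v.adicCompletion ↥(maximalRealSubfield L))) {γ : GL (Fin 2) (v.adicCompletion ↥(maximalRealSubfield L))}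
    (hγ : (γ : Matrix (Fin 2) (Fin 2) (v.adicCompletion ↥(maximalRealSubfield L))) = !![a, b * v₀; b, a + b * u₀]) :
    ((((glDiagonal 2 (v.adicCompletion ↥(maximalRealSubfield L)) ![1, Units.mk0 (c) (hc0)]) ^ m)⁻¹ * γ * (glDiagonal 2 (v.adicCompletion ↥(maximalRealSubfield L)) ![1, Units.mk0 (c) (hc0)]) ^ m : GL (Fin 2) (v.adicCompletion ↥(maximalRealSubfield L))) : Matrix (Fin 2) (Fin 2) (v.adicCompletion ↥(maximalRealSubfield L))) =
      !![a, b * v₀ * c ^ m; b * (c ^ m)⁻¹, a + b * u₀] := by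
  rw [Units.val_mul, Units.val_mul, coe_glDiagonal_one_mk0_pow_inv L v hc0, coe_glDiagonal_one_mk0_pow L v hc0, hγ]
  exact diagonal_inv_mul_regRep_mul_diagonal u₀ v₀ c hc0 m a b

include hα0 in
/-- **THE DESCENT OF THE SHELL CONJUGATE, MATRIX FORM**: descent `s · ι(a, b v₀; b, a + b u₀)` of `T` ⇒ descent `s · ι(a, b v₀ c^m; b (c^m)⁻¹, a + b u₀)` of `r_m⁻¹ T r_m`.
[cite: LabesseLanglands1979, §2 (2.1) p. 8] -/
theorem descent_shellConjugate_regRep (uη T : ↥(unitaryGroupOfForm (galAdicCompletionMap (L := L) (IsCMField.complexConj L) hw) (placeForm (Matrix.of fun i j : Fin 2 => if i.val + j.val + 1 = 2 then (1 : L) else 0) w.1))) {η : (w.1.adicCompletion L)} (hη0 : η ≠ 0)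
    (huη : ((uη : GL (Fin 2) (w.1.adicCompletion L)) : Matrix (Fin 2) (Fin 2) (w.1.adicCompletion L)) = Matrix.diagonal ![η, ((galAdicCompletionMap (L := L) (IsCMField.complexConj L) hw) η)⁻¹])
    {c : (v.adicCompletion ↥(maximalRealSubfield L))} (hc0 : c ≠ 0) (hc : toPlace v w c = η * (galAdicCompletionMap (L := L) (IsCMField.complexConj L) hw) η) (m : ℕ)
    {s : (w.1.adicCompletion L)} {γ : GL (Fin 2) (v.adicCompletion ↥(maximalRealSubfield L))} (u₀ v₀ a b : (v.adicCompletion ↥(maximalRealSubfield L))) (hγ : (γ : Matrix (Fin 2) (Fin 2) (v.adicCompletion ↥(maximalRealSubfield L))) = !![a, b * v₀; b, a + b * u₀])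
    (hT : Matrix.diagonal ![1, α] * ((T : GL (Fin 2) (w.1.adicCompletion L)) : Matrix (Fin 2) (Fin 2) (w.1.adicCompletion L)) * Matrix.diagonal ![1, α⁻¹] = s • (γ : Matrix (Fin 2) (Fin 2) (v.adicCompletion ↥(maximalRealSubfield L))).map (toPlace v w)) :
    Matrix.diagonal ![1, α] * ((((uη⁻¹ ^ m)⁻¹ * T * uη⁻¹ ^ m : ↥(unitaryGroupOfForm (galAdicCompletionMap (L := L) (IsCMField.complexConj L) hw) (placeForm (Matrix.of fun i j : Fin 2 => if i.val + j.val + 1 = 2 then (1 : L) else 0) w.1))) : GL (Fin 2) (w.1.adicCompletion L)) : Matrix (Fin 2) (Fin 2) (w.1.adicCompletion L)) * Matrix.diagonal ![1, α⁻¹] =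
      s • (!![a, b * v₀ * c ^ m; b * (c ^ m)⁻¹, a + b * u₀]).map (toPlace v w) := by
  rw [descent_shellConjugate L v w hw hα0 uη T hη0 huη hc0 hc m hT, coe_glDiagonal_pow_conj_regRep L v hc0 m u₀ v₀ a b hγ]

end Place

/-! ## §3 The `fbar` link on `H_v` -/

section Link

variable (L : Type) [Field L] [NumberField L] [IsCMField L] (v : HeightOneSpectrum (𝓞 ↥(maximalRealSubfield L)))
  (w : PlacesOver L v) (hw : IsCMField.complexConj L • w.1 = w.1)
  (E₂ : (cmDatum L 2 (Matrix.of fun i j : Fin 2 => if i.val + j.val + 1 = 2 then (1 : L) else 0)).Local v ≃ₜ* ↥(unitaryGroupOfForm (galAdicCompletionMap (L := L) (IsCMField.complexConj L) hw) (placeForm (Matrix.of fun i j : Fin 2 => if i.val + j.val + 1 = 2 then (1 : L) else 0) w.1)))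

/-- **`(E₂⁻¹ r, 1)⁻¹ · x · (E₂⁻¹ r, 1) = (E₂⁻¹ (r⁻¹ E₂(x₁) r), x₂)`** — so `fbar m x` is the `K × U₁`-average at the shell conjugate `r_m⁻¹ E₂(x₁) r_m`.
[cite: LabesseLanglands1979, §2 p. 8] -/
theorem prod_symm_one_inv_mul_mul (r : ↥(unitaryGroupOfForm (galAdicCompletionMap (L := L) (IsCMField.complexConj L) hw) (placeForm (Matrix.of fun i j : Fin 2 => if i.val + j.val + 1 = 2 then (1 : L) else 0) w.1))) (x : ((cmDatum L 2 (Matrix.of fun i j : Fin 2 => if i.val + j.val + 1 = 2 then (1 : L) else 0)).Local v × (cmDatum L 1 (Matrix.of fun i j : Fin 1 => if i.val + j.val + 1 = 1 then (1 : L) else 0)).Local v)) :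
    ((E₂.symm r, (1 : (cmDatum L 1 (Matrix.of fun i j : Fin 1 => if i.val + j.val + 1 = 1 then (1 : L) else 0)).Local v)) : ((cmDatum L 2 (Matrix.of fun i j : Fin 2 => if i.val + j.val + 1 = 2 then (1 : L) else 0)).Local v × (cmDatum L 1 (Matrix.of fun i j : Fin 1 => if i.val + j.val + 1 = 1 then (1 : L) else 0)).Local v))⁻¹ * x * (E₂.symm r, 1) = (E₂.symm (r⁻¹ * E₂ x.1 * r), x.2) := by
  refine Prod.ext ?_ ?_
  · simp only [Prod.fst_mul, Prod.fst_inv, map_mul, map_inv, ContinuousMulEquiv.symm_apply_apply]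
  · simp only [Prod.snd_mul, Prod.snd_inv, inv_one, one_mul, mul_one]

end Link


end Literature.NumberTheory.Rogawski1990

end
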